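import Summits.NavierStokesRegularity.FluidComputer.GateBudgetDLedger
import HarnessLib

/-!
# GateBudget part 81 — the d-ledger summed along the clean ladder (§237–§238)

Cell `pub-fluidc`, blueprint seat bp1 (gen 36, eighth item: THE d-LEDGER IV, SPEC-INPUT-bp1
§BL(4)–(5)); namespace `Summit.NavierStokesRegularity.FluidComputer.GateBudget`, headline
member `RotorKnob.rotorCircuit K K¹⁰ ε ρ` of the two-scale family from `delayInit` (5.6),
`K ≥ 16`, on the lattice window `200ε/K²⁰ ≤ ρ² ≤ 2ε/K¹⁰`, `ε² ≤ 1/(6K²⁰)`, `ε = kK¹⁰ρ²`;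
modes `0 = a` (carrier), `1 = b` (clock), `2 = c` (trigger), `3 = d` (transfer), `4 = ã`
(output). HONEST FRAMING: a low prior, high value-of-information experiment on Tao's machine
paradigm; NOT a claim that NS blows up.

WHAT. Part 80 §236 `knob_rung_ledger` is the one-step law of the d-ledger on a clean lattice
rung: `|d(r')| ≤ e^{-(9/4)Kã(T')}·(|d(r)| + (5k + (k/2 + 4)Kã(T'))/K¹⁰) + 3/K⁹` together
with the output floor `ã(T') ≥ ã(r) + 1/K⁹` and cold monotonicity `ã(r') ≥ ã(T')`. §238
`knob_ladder_climb_ledger` runs part 67 §208's induction (the generic fine climb: same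
hypotheses, same six conclusions per rung) with part 80's rung map and carries three more
invariants along the ladder `r₁ = r₀, r_{n+1} = r'_n`: the output staircase `ã(rₙ) ≥ A₀ +
(n - 1)/K⁹` and the two-regime transfer ledger `|d(rₙ)| ≤ D₀ + (n - 1)·J`, `|d(rₙ)| ≤ D₀ + (1 +
(10/9)K⁸/n)·J` with the uniform injection `J = ((61/12)k + 2/3)/K¹⁰ + 3/K⁹`; §238
`knob_ladder_dledger` is the corollary `|d(rₙ)| ≤ D₀ + (1 + (10/9)K⁴)·J` for every rung — the
transfer mode NEVER ACCUMULATES along the clean ladder (`(1 + (10/9)K⁴)·J ≤ (3.4 + 0.4k)/K⁵`).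
HOW (§237, pure real analysis). (a) `injection_numerics`: `x·e^{-(9/4)x} ≤ 1/6` (from `1 + y ≤
eʸ` at `y = (9/4)x - 1` and `e ≥ 8/3`), so part 80's level-dependent injection is `≤ (61/12)k +
2/3` over `K¹⁰` uniformly; (b) `memory_step`: for `y > 0` and `0 ≤ c ≤ (4/9)y²`,
`e^{-y}(1 + (5/2)/y) + 1 ≤ 1 + (5/2)/(y + c)` (from `eʸ ≥ (1 + y/2)²`) — the Gaussian damping
product in closed form: the effective memory `W` obeys `W ↦ e^{-y}W + 1` with `y ≥
(9/4)(j + 1)/K⁸` after `j` rungs, and `1 + (10/9)K⁸/(j + 1) = 1 + (5/2)/y` is invariant once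
`(j + 1)² ≥ K⁸`, while `W ≤ j + 1` covers `(j + 1)² < K⁸`; (c) `ledger_invariant_step` /
`ledger_invariant_final` package (b) as the induction step and read off `min(j, 1 +
(10/9)K⁸/(j + 1)) ≤ 1 + (10/9)K⁴`. §238 then follows part 67 §208 line by line, feeding part
80's three ledger conjuncts into (c) with `y = (9/4)Kã(T'ₙ) ≥ (9/4)·n/K⁸` (output staircase,
`A₀ ≥ 0`).
HONEST LIMITS. (i) `A₀ ≤ ã(r₀)` with `A₀ ≥ 0` and `|d(r₀)| ≤ D₀` are free inputs — the anchor
(parts 49–51) supplies them, this file does not; (ii) existence per rung exactly as part 67 (the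
`n`-th ignition is produced by the induction, no uniqueness); (iii) the budget hypotheses are
part 67's verbatim (pair slip `0.3(η′ + 310 log K/K⁹) + 6/K⁹` per rung, clock window
`286/K⁹` per rung) — replacing the pair slip by the ledgers is part 82; (iv) constants generous
(`W ≤ 1 + (10/9)K⁴` where `≈ 0.95K⁴` is true; `J` keeps part 80's `5k`); (v) upper bounds on
`|d|` and a lower staircase for `ã` only — the output's upper staircase is part 82; (vi)
nothing about Navier–Stokes.
[cite: Tao2016AveragedNS, §5.5 Theorem 5.3, (5.5), (5.6), (b-eq), (c-eq), (d-eq), (ta-eq),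
(energy-con), (est)]
-/

noncomputable section

namespace Summit.NavierStokesRegularity.FluidComputer.GateBudget

open Real Set Filter Topology
open Literature.Analysis.FluidPDE.Tao2016AveragedNS

variable {K ε ρ : ℝ} {X : ℝ → Fin 5 → ℝ} {C : ℝ → ℝ}

/-! ## §237 The summation: uniform injection, Gaussian memory, the two-regime invariant -/

/-- §237 UNIFORM INJECTION: `x·e^{-(9/4)x} ≤ 1/6` for every real `x`. [folklore] -/
theorem injection_numerics (x : ℝ) : exp (-(9 / 4 * x)) * x ≤ 1 / 6 := by
  have hE : 0 < exp (9 / 4 * x) := exp_pos _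
  rw [Real.exp_neg, inv_mul_le_iff₀ hE]
  rcases le_or_gt x 0 with hx | hx
  · nlinarith [hE, hx]
  · have h1 : 9 / 4 * x - 1 + 1 ≤ exp (9 / 4 * x - 1) := add_one_le_exp _
    rw [Real.exp_sub, le_div_iff₀ (exp_pos 1)] at h1
    have he : (8 / 3 : ℝ) ≤ exp 1 := by have := Real.exp_one_gt_d9; linarith
    nlinarith [h1, mul_le_mul_of_nonneg_left he (show (0 : ℝ) ≤ 9 / 4 * x by linarith)]

/-- §237 GAUSSIAN MEMORY STEP: `0 < y`, `0 ≤ c ≤ (4/9)y²` ⇒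
`e^{-y}(1 + (5/2)/y) + 1 ≤ 1 + (5/2)/(y + c)`. [folklore] -/
theorem memory_step {y c : ℝ} (hy : 0 < y) (hc : 0 ≤ c) (hcy : c ≤ 4 / 9 * y ^ 2) :
    exp (-y) * (1 + 5 / 2 / y) + 1 ≤ 1 + 5 / 2 / (y + c) := by
  have hE : (1 + y / 2) ^ 2 ≤ exp y := by
    have h := add_one_le_exp (y / 2)
    have h2 : (y / 2 + 1) ^ 2 ≤ exp (y / 2) ^ 2 := pow_le_pow_left₀ (by linarith) h 2
    have h3 : exp (y / 2) ^ 2 = exp y := by rw [sq, ← Real.exp_add]; ring_nf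
    nlinarith [h2, h3]
  suffices h : exp (-y) * (1 + 5 / 2 / y) ≤ 5 / 2 / (y + c) by linarith
  rw [Real.exp_neg, inv_mul_le_iff₀ (exp_pos y),
    show 1 + 5 / 2 / y = (y + 5 / 2) / y by rw [add_div, div_self hy.ne'], div_le_iff₀ hy,
    show exp y * (5 / 2 / (y + c)) * y = 5 / 2 * y * exp y / (y + c) by ring,
    le_div_iff₀ (by linarith)]
  have hE' : y * (1 + y / 2) ^ 2 ≤ y * exp y := mul_le_mul_of_nonneg_left hE hy.le
  have hc' : (y + 5 / 2) * c ≤ (y + 5 / 2) * (4 / 9 * y ^ 2) :=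
    mul_le_mul_of_nonneg_left hcy (by linarith)
  nlinarith [hE', hc', sq_nonneg y, mul_nonneg hy.le (sq_nonneg y)]

/-- §237 THE TWO-REGIME INVARIANT, STEP (`K > 0`, `J ≥ 0`, `u₀ ≥ 0`, `u ≥ 0`, `j ≥ 0` rungs
done, damping exponent `y ≥ (9/4)(j + 1)/K⁸`): `u ≤ u₀ + j·J`, `u ≤ u₀ + (1 + (10/9)K⁸/(j +
1))·J` and `u' ≤ e^{-y}u + J` ⇒ the same two bounds for `u'` with `j + 1`. [folklore] -/
theorem ledger_invariant_step {K J u₀ u u' y j : ℝ} (hK : 0 < K) (hJ : 0 ≤ J) (hu₀ : 0 ≤ u₀)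
    (hu : 0 ≤ u) (hj : 0 ≤ j) (hy : 9 / 4 * (j + 1) / K ^ 8 ≤ y) (h1 : u ≤ u₀ + j * J)
    (h2 : u ≤ u₀ + (1 + 10 / 9 * K ^ 8 / (j + 1)) * J) (hrec : u' ≤ exp (-y) * u + J) :
    u' ≤ u₀ + (j + 1) * J ∧ u' ≤ u₀ + (1 + 10 / 9 * K ^ 8 / (j + 2)) * J := by
  have hK8 : (0 : ℝ) < K ^ 8 := by positivity
  have hy0 : 0 < y := lt_of_lt_of_le (by positivity) hy
  have hq1 : exp (-y) ≤ 1 := by rw [Real.exp_le_one_iff]; linarith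
  have hA : u' ≤ u + J := by linarith [hrec, mul_le_of_le_one_left hu hq1]
  have hfirst : u' ≤ u₀ + (j + 1) * J := by linarith [hA, h1]
  refine ⟨hfirst, ?_⟩
  by_cases hcase : (j + 1) ^ 2 < K ^ 8
  · -- young ladder: `j + 1 ≤ 1 + (10/9)K⁸/(j + 2)`
    have hj2 : 0 < j + 2 := by linarith
    have hnum : j ≤ 10 / 9 * K ^ 8 / (j + 2) := by
      rw [le_div_iff₀ hj2]; nlinarith [hcase]
    nlinarith [hfirst, mul_le_mul_of_nonneg_right hnum hJ]
  · -- old ladder: the Gaussian memory step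
    have hcase' : K ^ 8 ≤ (j + 1) ^ 2 := not_lt.mp hcase
    obtain ⟨w, hw⟩ : ∃ w : ℝ, w = 9 / 4 * (j + 1) / K ^ 8 := ⟨_, rfl⟩
    have hw0 : 0 < w := by rw [hw]; positivity
    have hj1 : (j + 1) ≠ 0 := by positivity
    have hj2 : (j + 2) ≠ 0 := by positivity
    have hcw : 9 / 4 / K ^ 8 ≤ 4 / 9 * w ^ 2 := by
      have e : 4 / 9 * w ^ 2 = 9 / 4 * (j + 1) ^ 2 / K ^ 8 / K ^ 8 := by rw [hw]; ring
      rw [e]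
      apply div_le_div_of_nonneg_right _ hK8.le
      rw [le_div_iff₀ hK8]; nlinarith [hcase']
    have hms := memory_step hw0 (by positivity : (0 : ℝ) ≤ 9 / 4 / K ^ 8) hcw
    have e1 : 10 / 9 * K ^ 8 / (j + 1) = 5 / 2 / w := by rw [hw]; field_simp; ring
    have e2 : 10 / 9 * K ^ 8 / (j + 2) = 5 / 2 / (w + 9 / 4 / K ^ 8) := by
      rw [hw]; field_simp; ring
    rw [e2]
    rw [e1] at h2
    have hq0 : 0 ≤ exp (-w) := (exp_pos _).le
    have hq1' : exp (-w) ≤ 1 := by rw [Real.exp_le_one_iff]; linarith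
    have hqq : exp (-y) ≤ exp (-w) := Real.exp_le_exp.mpr (by rw [hw]; linarith [hy])
    have hB : u' ≤ exp (-w) * u + J := by linarith [hrec, mul_le_mul_of_nonneg_right hqq hu]
    have s1 : exp (-w) * u ≤ exp (-w) * (u₀ + (1 + 5 / 2 / w) * J) :=
      mul_le_mul_of_nonneg_left h2 hq0
    have s2 : exp (-w) * u₀ ≤ u₀ := mul_le_of_le_one_left hu₀ hq1'
    have s3 : J * (exp (-w) * (1 + 5 / 2 / w) + 1) ≤ J * (1 + 5 / 2 / (w + 9 / 4 / K ^ 8)) :=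
      mul_le_mul_of_nonneg_left hms hJ
    linarith [hB, s1, s2, s3]

/-- §237 THE TWO-REGIME INVARIANT, READ-OUT (`K > 0`, `J ≥ 0`, `j ≥ 0`): `u ≤ u₀ + j·J` and
`u ≤ u₀ + (1 + (10/9)K⁸/(j + 1))·J` ⇒ `u ≤ u₀ + (1 + (10/9)K⁴)·J`. [folklore] -/
theorem ledger_invariant_final {K J u₀ u j : ℝ} (hK : 0 < K) (hJ : 0 ≤ J) (hj : 0 ≤ j)
    (h1 : u ≤ u₀ + j * J) (h2 : u ≤ u₀ + (1 + 10 / 9 * K ^ 8 / (j + 1)) * J) :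
    u ≤ u₀ + (1 + 10 / 9 * K ^ 4) * J := by
  have hK4 : (0 : ℝ) < K ^ 4 := by positivity
  by_cases hm : j ≤ K ^ 4
  · nlinarith [h1, mul_le_mul_of_nonneg_right hm hJ]
  · have hm' : K ^ 4 < j := not_le.mp hm
    have hj1 : 0 < j + 1 := by linarith
    have hnum : 10 / 9 * K ^ 8 / (j + 1) ≤ 10 / 9 * K ^ 4 := by
      rw [div_le_iff₀ hj1]
      have : K ^ 8 = K ^ 4 * K ^ 4 := by ring
      rw [this]; nlinarith [hm'.le, hK4]
    nlinarith [h2, mul_le_mul_of_nonneg_right hnum hJ]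

/-! ## §238 The d-ledger along the clean ladder -/

/-- §238 THE GENERIC CLIMB WITH THE d-LEDGER (part 67 §208 `knob_ladder_climb_fine` verbatim —
same hypotheses, same six conclusions per rung — run with part 80 §236's rung map and three
more invariants). Headline member with a trigger primitive on the lattice window; an ignition
`r₀ ≥ 0` in normal form `b(r₀) = θ₀ε`, `c(r₀) = ρ²/K⁹`, `P(r₀) ≤ P₁`, with `5/4 + (N - 1)·286/K⁹
≤ θ₀ ≤ 29/20`, `(N - 1)·286/K⁹ ≤ 0.14999`, `P₁ + N·s′ ≤ 1/50` (`s′ = 0.3(η′ + 310 log K/K⁹) +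
6/K⁹`), and anchor data `0 ≤ A₀ ≤ ã(r₀)`, `|d(r₀)| ≤ D₀` ⇒ for every `1 ≤ n ≤ N` an ignition
`rₙ ≥ r₀ + (n - 1)` with part 67's conclusions AND `ã(rₙ) ≥ A₀ + (n - 1)/K⁹`, `|d(rₙ)| ≤ D₀ +
(n - 1)·J`, `|d(rₙ)| ≤ D₀ + (1 + (10/9)K⁸/n)·J`, `J = ((61/12)k + 2/3)/K¹⁰ + 3/K⁹`.
[derived: part 80 §236, this file §237, `Nat.le_induction`] -/
theorem knob_ladder_climb_ledger
    (hX : ∀ t, HasDerivAt X (RotorKnob.rotorCircuit K (K ^ 10) ε ρ (X t)) t)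
    (h0 : X 0 = delayInit) (hC : ∀ t, HasDerivAt C (X t 2) t) (hK : 16 ≤ K)
    (hε : 0 < ε) (hεK : ε ^ 2 ≤ 1 / (6 * K ^ 20)) (hρ : 0 < ρ)
    (hlo : 200 * ε / K ^ 20 ≤ ρ ^ 2) (hhi : K ^ 10 * ρ ^ 2 ≤ 2 * ε) (k : ℕ)
    (hk : ε = k * K ^ 10 * ρ ^ 2) {r₀ θ₀ P₁ A₀ D₀ : ℝ} {N : ℕ} (hr₀ : 0 ≤ r₀)
    (hb₀ : X r₀ 1 = θ₀ * ε) (hc₀ : X r₀ 2 = ρ ^ 2 / K ^ 9) (hP₁ : X r₀ 3 ^ 2 + X r₀ 4 ^ 2 ≤ P₁)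
    (hθ₀lo : 5 / 4 + ((N : ℝ) - 1) * (286 / K ^ 9) ≤ θ₀) (hθ₀hi : θ₀ ≤ 29 / 20)
    (hNθ : ((N : ℝ) - 1) * (286 / K ^ 9) ≤ 14999 / 100000)
    (hNP : P₁ + (N : ℝ) * (3 * (k * π / ((25 / 16 - 1 / 10 ^ 6) * K ^ 10 - 1) + 1 / K ^ 19
      + 310 * log K / K ^ 9) / 10 + 6 / K ^ 9) ≤ 1 / 50)
    (hA0 : 0 ≤ A₀) (hA₀ : A₀ ≤ X r₀ 4) (hD₀ : |X r₀ 3| ≤ D₀) :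
    ∀ n : ℕ, 1 ≤ n → n ≤ N → ∃ r θ : ℝ, r₀ + ((n : ℝ) - 1) ≤ r ∧ X r 1 = θ * ε ∧
      5 / 4 + ((N : ℝ) - n) * (286 / K ^ 9) ≤ θ ∧ θ ≤ 29 / 20 ∧ X r 2 = ρ ^ 2 / K ^ 9 ∧
      X r 3 ^ 2 + X r 4 ^ 2 ≤ P₁ + ((n : ℝ) - 1) * (3 * (k * π / ((25 / 16 - 1 / 10 ^ 6)
        * K ^ 10 - 1) + 1 / K ^ 19 + 310 * log K / K ^ 9) / 10 + 6 / K ^ 9) ∧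
      A₀ + ((n : ℝ) - 1) / K ^ 9 ≤ X r 4 ∧
      |X r 3| ≤ D₀ + ((n : ℝ) - 1) * ((61 / 12 * k + 2 / 3) / K ^ 10 + 3 / K ^ 9) ∧
      |X r 3| ≤ D₀ + (1 + 10 / 9 * K ^ 8 / n) * ((61 / 12 * k + 2 / 3) / K ^ 10 + 3 / K ^ 9) := by
  obtain ⟨-, -, -, hδ0, -, -⟩ := rung_numerics hK hε hρ hlo k hk
  have hK0 : (0 : ℝ) < K := by linarith
  have hK8 : (0 : ℝ) < K ^ 8 := by positivity
  have hK9 : (0 : ℝ) < K ^ 9 := by positivity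
  have hK10 : (0 : ℝ) < K ^ 10 := by positivity
  have hk0 : (0 : ℝ) ≤ k := Nat.cast_nonneg k
  have h286 : (0 : ℝ) ≤ 286 / K ^ 9 := by positivity
  have h310 : (0 : ℝ) ≤ 310 * log K / K ^ 9 :=
    div_nonneg (mul_nonneg (by norm_num) (Real.log_nonneg (by linarith))) (by positivity)
  have h6 : (0 : ℝ) ≤ 6 / K ^ 9 := by positivity
  have hD0 : 0 ≤ D₀ := le_trans (abs_nonneg _) hD₀
  obtain ⟨s, hs_def⟩ : ∃ s : ℝ, s = 3 * (k * π / ((25 / 16 - 1 / 10 ^ 6) * K ^ 10 - 1)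
      + 1 / K ^ 19 + 310 * log K / K ^ 9) / 10 + 6 / K ^ 9 := ⟨_, rfl⟩
  have hs0 : 0 ≤ s := by rw [hs_def]; linarith only [hδ0, h310, h6]
  obtain ⟨J, hJ_def⟩ : ∃ J : ℝ, J = (61 / 12 * k + 2 / 3) / K ^ 10 + 3 / K ^ 9 := ⟨_, rfl⟩
  have hJ0 : 0 ≤ J := by rw [hJ_def]; positivity
  simp only [← hs_def, ← hJ_def] at hNP ⊢
  intro n hn
  induction n, hn using Nat.le_induction with
  | base =>
    intro _
    refine ⟨r₀, θ₀, by simp, hb₀, by simpa using hθ₀lo, hθ₀hi, hc₀, by simpa using hP₁,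
      by simpa using hA₀, by simpa using hD₀, ?_⟩
    have : 0 ≤ (1 + 10 / 9 * K ^ 8) * J := mul_nonneg (by positivity) hJ0
    norm_num; linarith only [hD₀, this]
  | succ m hm ih =>
    intro hmN
    obtain ⟨r, θ, hr, hb, hθlo, hθhi, hc, hP, hA, hd1, hd2⟩ := ih (Nat.le_of_succ_le hmN)
    have hm1 : (1 : ℝ) ≤ m := by exact_mod_cast hm
    have hmN' : (m : ℝ) + 1 ≤ N := by exact_mod_cast hmN
    have hNm : 0 ≤ ((N : ℝ) - m) * (286 / K ^ 9) := mul_nonneg (by linarith) h286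
    have hmq : 0 ≤ (m : ℝ) * (286 / K ^ 9) := mul_nonneg (by linarith) h286
    have hr0 : 0 ≤ r := by linarith only [hr₀, hr, hm1]
    have hθ1 : 5 / 4 ≤ θ := by linarith only [hθlo, hNm]
    have hms : ((m : ℝ) - 1) * s + s ≤ N * s := by nlinarith only [hs0, hmN']
    have key : X r 3 ^ 2 + X r 4 ^ 2 + s ≤ 1 / 50 := by linarith only [hP, hNP, hms]
    have hPr : X r 3 ^ 2 + X r 4 ^ 2 + 3 * (k * π / ((25 / 16 - 1 / 10 ^ 6) * K ^ 10 - 1)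
        + 1 / K ^ 19 + 310 * log K / K ^ 9) / 10 + 6 / K ^ 9 ≤ 1 / 50 := by
      rw [hs_def] at key; linarith only [key]
    obtain ⟨T', θ₁, tz, r', θ', -, ⟨-, -, -, -, -, hc'⟩, ⟨hb', hθ'hi, hθ'lo, hP', hrr'⟩,
        hfl, -, hdT, -, hdr', hmono, -⟩ :=
      knob_rung_ledger hX h0 hC hK hε hεK hρ hlo hhi k hk hr0 hθ1 hθhi hb hc hPr
    have hP's : X r' 3 ^ 2 + X r' 4 ^ 2 ≤ X r 3 ^ 2 + X r 4 ^ 2 + s := by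
      rw [hs_def]; linarith only [hP']
    -- the three ledger invariants
    obtain ⟨x, hx⟩ : ∃ x : ℝ, x = K * X T' 4 := ⟨_, rfl⟩
    have hmK : (m : ℝ) / K ^ 9 ≤ X T' 4 := by
      have e : ((m : ℝ) - 1) / K ^ 9 + 1 / K ^ 9 = (m : ℝ) / K ^ 9 := by ring
      linarith only [hA, hfl, hA0, e]
    have hxm : (m : ℝ) / K ^ 8 ≤ x := by
      have e : K * ((m : ℝ) / K ^ 9) = (m : ℝ) / K ^ 8 := by field_simp
      rw [hx, ← e]; exact mul_le_mul_of_nonneg_left hmK hK0.le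
    have hx0 : 0 ≤ x := le_trans (by positivity) hxm
    have he0 : 0 ≤ exp (-(9 / 4 * x)) := (exp_pos _).le
    have he1 : exp (-(9 / 4 * x)) ≤ 1 := by rw [Real.exp_le_one_iff]; linarith
    have hinj : exp (-(9 / 4 * x)) * (5 * k + (k / 2 + 4) * x) ≤ 61 / 12 * k + 2 / 3 := by
      have f1 := mul_le_of_le_one_left (by positivity : (0 : ℝ) ≤ 5 * k) he1
      have f2 := mul_le_mul_of_nonneg_left (injection_numerics x)
        (by positivity : (0 : ℝ) ≤ k / 2 + 4)
      linarith [f1, f2]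
    have hinj' : exp (-(9 / 4 * x)) * ((5 * k + (k / 2 + 4) * x) / K ^ 10)
        ≤ (61 / 12 * k + 2 / 3) / K ^ 10 := by
      rw [← mul_div_assoc]; exact div_le_div_of_nonneg_right hinj hK10.le
    rw [← hx] at hdT hdr'
    have hprod := mul_le_mul_of_nonneg_right hdT he0
    have hrec : |X r' 3| ≤ exp (-(9 / 4 * x)) * |X r 3| + J := by
      rw [hJ_def]; linarith [hdr', hprod, hinj']
    have hy : 9 / 4 * (((m : ℝ) - 1) + 1) / K ^ 8 ≤ 9 / 4 * x := by
      have e : ((m : ℝ) - 1) + 1 = m := by ring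
      rw [e, mul_div_assoc]; linarith only [hxm]
    have em1 : ((m : ℝ) - 1) + 1 = m := by ring
    obtain ⟨hd1', hd2'⟩ := ledger_invariant_step hK0 hJ0 hD0 (abs_nonneg _) (by linarith) hy
      hd1 (by rw [em1]; exact hd2) hrec
    have em : ((m : ℝ) - 1) + 2 = (m : ℝ) + 1 := by ring
    rw [em] at hd2'
    refine ⟨r', θ', ?_, hb', ?_, by linarith only [hθ'hi], hc', ?_, ?_, ?_, ?_⟩
    · push_cast; linarith only [hr, hrr']
    · push_cast
      rcases hθ'lo with h | h
      · linarith only [hθlo, h]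
      · linarith only [hNθ, h, hmq]
    · push_cast; linarith only [hP, hP's]
    · have e' : (((m + 1 : ℕ) : ℝ) - 1) / K ^ 9 = ((m : ℝ) - 1) / K ^ 9 + 1 / K ^ 9 := by
        push_cast; ring
      linarith only [hA, hfl, hmono, e']
    · push_cast; linarith only [hd1']
    · push_cast; exact hd2'

/-- §238 THE d-LEDGER SUMMED: under §238 `knob_ladder_climb_ledger`'s hypotheses, at every
rung `1 ≤ n ≤ N` the ignition `rₙ` it produces has `ã(rₙ) ≥ A₀ + (n - 1)/K⁹` and `|d(rₙ)| ≤
D₀ + (1 + (10/9)K⁴)·(((61/12)k + 2/3)/K¹⁰ + 3/K⁹)` — uniformly in `n`: the transfer mode does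
not accumulate along the clean ladder. [derived: this file §237–§238] -/
theorem knob_ladder_dledger
    (hX : ∀ t, HasDerivAt X (RotorKnob.rotorCircuit K (K ^ 10) ε ρ (X t)) t)
    (h0 : X 0 = delayInit) (hC : ∀ t, HasDerivAt C (X t 2) t) (hK : 16 ≤ K)
    (hε : 0 < ε) (hεK : ε ^ 2 ≤ 1 / (6 * K ^ 20)) (hρ : 0 < ρ)
    (hlo : 200 * ε / K ^ 20 ≤ ρ ^ 2) (hhi : K ^ 10 * ρ ^ 2 ≤ 2 * ε) (k : ℕ)
    (hk : ε = k * K ^ 10 * ρ ^ 2) {r₀ θ₀ P₁ A₀ D₀ : ℝ} {N : ℕ} (hr₀ : 0 ≤ r₀)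
    (hb₀ : X r₀ 1 = θ₀ * ε) (hc₀ : X r₀ 2 = ρ ^ 2 / K ^ 9) (hP₁ : X r₀ 3 ^ 2 + X r₀ 4 ^ 2 ≤ P₁)
    (hθ₀lo : 5 / 4 + ((N : ℝ) - 1) * (286 / K ^ 9) ≤ θ₀) (hθ₀hi : θ₀ ≤ 29 / 20)
    (hNθ : ((N : ℝ) - 1) * (286 / K ^ 9) ≤ 14999 / 100000)
    (hNP : P₁ + (N : ℝ) * (3 * (k * π / ((25 / 16 - 1 / 10 ^ 6) * K ^ 10 - 1) + 1 / K ^ 19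
      + 310 * log K / K ^ 9) / 10 + 6 / K ^ 9) ≤ 1 / 50)
    (hA0 : 0 ≤ A₀) (hA₀ : A₀ ≤ X r₀ 4) (hD₀ : |X r₀ 3| ≤ D₀) :
    ∀ n : ℕ, 1 ≤ n → n ≤ N → ∃ r θ : ℝ, r₀ + ((n : ℝ) - 1) ≤ r ∧ X r 1 = θ * ε ∧
      5 / 4 + ((N : ℝ) - n) * (286 / K ^ 9) ≤ θ ∧ θ ≤ 29 / 20 ∧ X r 2 = ρ ^ 2 / K ^ 9 ∧
      X r 3 ^ 2 + X r 4 ^ 2 ≤ P₁ + ((n : ℝ) - 1) * (3 * (k * π / ((25 / 16 - 1 / 10 ^ 6)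
        * K ^ 10 - 1) + 1 / K ^ 19 + 310 * log K / K ^ 9) / 10 + 6 / K ^ 9) ∧
      A₀ + ((n : ℝ) - 1) / K ^ 9 ≤ X r 4 ∧
      |X r 3| ≤ D₀ + (1 + 10 / 9 * K ^ 4) * ((61 / 12 * k + 2 / 3) / K ^ 10 + 3 / K ^ 9) := by
  intro n hn hnN
  obtain ⟨r, θ, hr, hb, hθlo, hθhi, hc, hP, hA, hd1, hd2⟩ := knob_ladder_climb_ledger hX h0 hC
    hK hε hεK hρ hlo hhi k hk hr₀ hb₀ hc₀ hP₁ hθ₀lo hθ₀hi hNθ hNP hA0 hA₀ hD₀ n hn hnN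
  have hK0 : (0 : ℝ) < K := by linarith
  have hn1 : (1 : ℝ) ≤ n := by exact_mod_cast hn
  have e : ((n : ℝ) - 1) + 1 = n := by ring
  refine ⟨r, θ, hr, hb, hθlo, hθhi, hc, hP, hA, ?_⟩
  exact ledger_invariant_final hK0 (by positivity) (by linarith) hd1 (by rw [e]; exact hd2)

end Summit.NavierStokesRegularity.FluidComputer.GateBudget

end
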